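import Summits.QuantumFields.BalabanUV.T4Continuum.Support.NE7BlockDefectSymbol

/-!
# NE7BlockDefectSymbolBound — row NE7 (node U5), source route HOM (K2a) feeding «PAIR-CAUCHY»: the K2a ABELIAN SYMBOL
# LEMMA, part 2 — the defect FORM: GLOBAL sign and the GLOBAL quartic bound with the SHARP constant `(L²−1)∕12`;
# the scalar block-mean defect `D0 ≤ ((L²−1)∕12)(|p|⁴ + Σp_μ⁴)` and the `d = 1` Laplacian defect `D1 ≤ ((L²−1)∕6)θ⁴`

Companion of `Support/NE7BlockDefectSymbol` (same lineage `b2b-balaban-t4-ne7-p2`, CRUX PROVER NE7 #2, generation 50; same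
honest framing, citation header and dictionary — read that file's docblock first: the object is the CLOSED FORM of
balaban-calc R-calc-40 §2 for the diagonal Bloch block of `S_f − S_c∘Q`, `Q` = Bałaban's block average
[Balaban1985Averaging] (14)∕(48) linearised and abelian; the identification closed form ↔ operator is the calc lane's three
codes, NOT kernel).  HONEST FRAMING (page 1): FIXED FINITE T⁴, rung (B)+1, CONDITIONAL on BetaPertH and the nine spine
estimates (0/9 proved); NOT infinite volume, NOT a mass gap, NOT the Clay problem; NE7 NOT PRINTED ∕ NOT PROVED.  Everything
below is [folklore] (Lagrange's identity, finite sums, the part-1 Fejér bound `one_sub_gSym_le` and weight bound `hW_le`); no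
cite tag is a hypothesis, nothing printed is asserted, no `sorry`.

WHAT IS PROVED ([folklore]; `s_m = sin(p_m∕2)`, `|s|² = Σ_λ s_λ² ≤ |p|²∕4`, direction set `ι` arbitrary finite):
§4 `defectForm L p a = Σ_mΣ_n h_mn(p)(s_n a_m − s_m a_n)²` (real polarisation; = the note's `ε†d(p)ε` with phases absorbed,
   full double sum = `2Σ_{m<n}`): `sum_sum_cross_sq` (Lagrange `Σ_mΣ_n(s_n a_m − s_m a_n)² = 2(|s|²|a|² − (s·a)²)`),
   **`defectForm_nonneg`** (the K2a ∕ P-HOM-1 ∕ LÖW-B1 sign, mode by mode), `defectForm_le_sinForm`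
   (`≤ (4(L²−1)∕3)|s|⁴|a|²`), **`defectForm_le`** (`≤ ((L²−1)∕12)·(Σ_λp_λ²)²·Σ_m a_m²` for ALL `p` — balaban-calc's
   LEADING-ORDER sup constant `(L²−1)∕12 = C(L)a_c²`, `C(L) = (1−L⁻²)∕12`, as a GLOBAL bound), and on complex
   polarisations `defectFormC_eq` (re∕im split), `defectFormC_nonneg`, **`defectFormC_le`** (same constant against `Σ‖ε_m‖²`).
§5 `scalarDefect L p = Σ_μ 4s_μ²(1 − g(p_μ)Π_λg(p_λ))` (the planner's `D0`): `scalarDefect_nonneg`, **`scalarDefect_le`**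
   (`≤ ((L²−1)∕12)((Σp_μ²)² + Σp_μ⁴)` globally); `laplaceDefect L θ = 4sin²(θ∕2)(1 − g(θ)²)` (`d = 1`, `g49/HOM-JUNCTION`
   §2): `laplaceDefect_nonneg`, **`laplaceDefect_le`** (`≤ ((L²−1)∕6)θ⁴` globally = the closed form's leading coefficient).
NOT PROVED HERE: closed form ↔ operator (calc lane); umklapp blocks; the non-linear non-abelian `𝔇`; anything of NE7.
Position-space companion in the tree: `Literature…/T4AveragingDeficit` (`deficit_nonpos`, `abs_deficit_le'`, constant
`6(d+2)n⁴` for the straight-stencil average) — this pair of files is the symbol-side certificate with the sharp constant.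
NOT NE7 (spine 0/9 unchanged), NOT summit progress.  HONEST DEPENDENCY: continuum YM on T⁴ ⇐ BetaPertH ∧ nine spine
estimates (0/9 proved); BetaPertH ⇐ (D1) ∧ (D4) ∧ CAP+tail; G-an2-4 gates asym, D1 and NE2/3/4.
-/

noncomputable section

open Finset Real
open scoped BigOperators

namespace Summit.QuantumFields.BalabanUV.T4Continuum.NE7BlockDefectSymbolBound

open Summit.QuantumFields.BalabanUV.T4Continuum.NE7BlockDefectSymbol

variable {ι : Type*} [Fintype ι] [DecidableEq ι]

/-! ## §4 The defect form: sign and the sharp global quartic bound -/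

/-- The closed-form diagonal Bloch defect on a REAL polarisation `a` (note §2, phases absorbed, full double sum):
`D_L(p)[a] = Σ_m Σ_n h_mn(p)·(sin(p_n∕2)a_m − sin(p_m∕2)a_n)²`. -/
def defectForm (L : ℕ) (p : ι → ℝ) (a : ι → ℝ) : ℝ :=
  ∑ m, ∑ n, hW L p m n * (sin (p n / 2) * a m - sin (p m / 2) * a n) ^ 2

omit [DecidableEq ι] in
/-- **LAGRANGE'S IDENTITY** for the cross form: `Σ_mΣ_n (s_n a_m − s_m a_n)² = 2(|s|²|a|² − (s·a)²)`. [folklore] -/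
theorem sum_sum_cross_sq (s a : ι → ℝ) :
    ∑ m, ∑ n, (s n * a m - s m * a n) ^ 2
      = 2 * ((∑ l, s l ^ 2) * (∑ l, a l ^ 2) - (∑ l, s l * a l) ^ 2) := by
  have e : ∀ m n, (s n * a m - s m * a n) ^ 2
      = a m ^ 2 * s n ^ 2 + s m ^ 2 * a n ^ 2 - 2 * ((s m * a m) * (s n * a n)) := by
    intro m n; ring
  have h1 : ∑ m, ∑ n, a m ^ 2 * s n ^ 2 = (∑ l, a l ^ 2) * ∑ l, s l ^ 2 := by rw [Finset.sum_mul_sum]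
  have h2 : ∑ m, ∑ n, s m ^ 2 * a n ^ 2 = (∑ l, s l ^ 2) * ∑ l, a l ^ 2 := by rw [Finset.sum_mul_sum]
  have h3 : ∑ m, ∑ n, 2 * ((s m * a m) * (s n * a n)) = 2 * (∑ l, s l * a l) ^ 2 := by
    rw [sq, Finset.sum_mul_sum]; simp only [Finset.mul_sum]
  simp_rw [e, Finset.sum_sub_distrib, Finset.sum_add_distrib]
  rw [h1, h2, h3]
  ring

omit [DecidableEq ι] in
/-- Consequence: `Σ_mΣ_n (s_n a_m − s_m a_n)² ≤ 2|s|²|a|²`. [folklore] -/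
theorem sum_sum_cross_sq_le (s a : ι → ℝ) :
    ∑ m, ∑ n, (s n * a m - s m * a n) ^ 2 ≤ 2 * ((∑ l, s l ^ 2) * (∑ l, a l ^ 2)) := by
  rw [sum_sum_cross_sq]
  nlinarith [sq_nonneg (∑ l, s l * a l)]

omit [DecidableEq ι] in
/-- **THE SIGN (K2a ∕ P-HOM-1 ∕ LÖW B1, mode by mode): `0 ≤ D_L(p)[a]`.** [folklore] -/
theorem defectForm_nonneg (L : ℕ) (p : ι → ℝ) (a : ι → ℝ) : 0 ≤ defectForm L p a :=
  Finset.sum_nonneg fun m _ => Finset.sum_nonneg fun n _ =>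
    mul_nonneg (hW_nonneg L p m n) (sq_nonneg _)

/-- Two distinct coordinates of a nonnegative family are dominated by the total. [folklore] -/
theorem add_le_sum_of_ne {f : ι → ℝ} (hf : ∀ l, 0 ≤ f l) {m n : ι} (hmn : m ≠ n) :
    f m + f n ≤ ∑ l, f l := by
  classical
  have h : ∑ l ∈ ({m, n} : Finset ι), f l ≤ ∑ l, f l :=
    Finset.sum_le_sum_of_subset_of_nonneg (Finset.subset_univ _) fun l _ _ => hf l
  rwa [Finset.sum_pair hmn] at h

/-- **IRRELEVANCE, trigonometric form.**  For `L ≥ 1`: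
`D_L(p)[a] ≤ (4(L²−1)∕3)·(Σ_λ sin²(p_λ∕2))²·Σ_m a_m²`. [folklore] -/
theorem defectForm_le_sinForm {L : ℕ} (hL : 1 ≤ L) (p : ι → ℝ) (a : ι → ℝ) :
    defectForm L p a ≤ 4 * ((L : ℝ) ^ 2 - 1) / 3 * (∑ l, sin (p l / 2) ^ 2) ^ 2 * ∑ m, a m ^ 2 := by
  set S : ℝ := ∑ l, sin (p l / 2) ^ 2 with hS
  have hL' : (0 : ℝ) ≤ ((L : ℝ) ^ 2 - 1) / 3 := by
    have : (1 : ℝ) ≤ L := by exact_mod_cast hL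
    have : (1 : ℝ) ≤ (L : ℝ) ^ 2 := by nlinarith
    linarith
  have hS0 : 0 ≤ S := Finset.sum_nonneg fun l _ => sq_nonneg _
  -- termwise: h_mn X_mn ≤ (2(L²−1)∕3)·S·X_mn
  have term : ∀ m n, hW L p m n * (sin (p n / 2) * a m - sin (p m / 2) * a n) ^ 2
      ≤ (2 * ((L : ℝ) ^ 2 - 1) / 3 * S) * (sin (p n / 2) * a m - sin (p m / 2) * a n) ^ 2 := by
    intro m n
    by_cases hmn : m = n
    · subst hmn; simp
    · have hsum : sin (p m / 2) ^ 2 + sin (p n / 2) ^ 2 ≤ S :=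
        add_le_sum_of_ne (fun l => sq_nonneg (sin (p l / 2))) hmn
      have hh : hW L p m n ≤ 2 * ((L : ℝ) ^ 2 - 1) / 3 * S := by
        calc hW L p m n ≤ ((L : ℝ) ^ 2 - 1) / 3 * (sin (p m / 2) ^ 2 + sin (p n / 2) ^ 2 + S) := hW_le hL p m n
          _ ≤ ((L : ℝ) ^ 2 - 1) / 3 * (S + S) := by gcongr
          _ = 2 * ((L : ℝ) ^ 2 - 1) / 3 * S := by ring
      exact mul_le_mul_of_nonneg_right hh (sq_nonneg _)
  calc defectForm L p a
      ≤ ∑ m, ∑ n, (2 * ((L : ℝ) ^ 2 - 1) / 3 * S) * (sin (p n / 2) * a m - sin (p m / 2) * a n) ^ 2 :=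
        Finset.sum_le_sum fun m _ => Finset.sum_le_sum fun n _ => term m n
    _ = (2 * ((L : ℝ) ^ 2 - 1) / 3 * S) * ∑ m, ∑ n, (sin (p n / 2) * a m - sin (p m / 2) * a n) ^ 2 := by
        simp only [Finset.mul_sum]
    _ ≤ (2 * ((L : ℝ) ^ 2 - 1) / 3 * S) * (2 * (S * ∑ m, a m ^ 2)) := by
        have h2 := sum_sum_cross_sq_le (fun l => sin (p l / 2)) a
        have hc : 0 ≤ 2 * ((L : ℝ) ^ 2 - 1) / 3 * S := mul_nonneg (by linarith) hS0
        exact mul_le_mul_of_nonneg_left h2 hc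
    _ = 4 * ((L : ℝ) ^ 2 - 1) / 3 * S ^ 2 * ∑ m, a m ^ 2 := by ring

omit [DecidableEq ι] in
/-- `Σ_λ sin²(p_λ∕2) ≤ |p|²∕4`. [folklore] -/
theorem sum_sin_sq_half_le (p : ι → ℝ) : ∑ l, sin (p l / 2) ^ 2 ≤ (∑ l, p l ^ 2) / 4 := by
  rw [Finset.sum_div]
  exact Finset.sum_le_sum fun l _ => sin_sq_half_le (p l)

/-- **K2a ABELIAN SYMBOL LEMMA (irrelevance with the SHARP constant, GLOBAL in `p`).**  For `L ≥ 1`, every momentum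
`p : ι → ℝ` and every real polarisation `a`:
`D_L(p)[a] ≤ ((L²−1)∕12)·(Σ_λ p_λ²)²·Σ_m a_m²`.
In coarse units `a_c = L` this is balaban-calc's `C(L)·a_c²·|p|⁴`, `C(L) = (1−L⁻²)∕12` (= 0.0625, 0.0741, 0.0828 for
`L = 2, 3, 12`), certified there as the LEADING-ORDER sup only; here it bounds the closed form for all `p`. [folklore] -/
theorem defectForm_le {L : ℕ} (hL : 1 ≤ L) (p : ι → ℝ) (a : ι → ℝ) :
    defectForm L p a ≤ ((L : ℝ) ^ 2 - 1) / 12 * (∑ l, p l ^ 2) ^ 2 * ∑ m, a m ^ 2 := by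
  have h1 := defectForm_le_sinForm hL p a
  have hS := sum_sin_sq_half_le p
  have hS0 : 0 ≤ ∑ l, sin (p l / 2) ^ 2 := Finset.sum_nonneg fun l _ => sq_nonneg _
  have hA0 : 0 ≤ ∑ m, a m ^ 2 := Finset.sum_nonneg fun m _ => sq_nonneg _
  have hL' : (0 : ℝ) ≤ ((L : ℝ) ^ 2 - 1) := by
    have : (1 : ℝ) ≤ L := by exact_mod_cast hL
    nlinarith
  have hsq : (∑ l, sin (p l / 2) ^ 2) ^ 2 ≤ ((∑ l, p l ^ 2) / 4) ^ 2 := pow_le_pow_left₀ hS0 hS 2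
  calc defectForm L p a ≤ 4 * ((L : ℝ) ^ 2 - 1) / 3 * (∑ l, sin (p l / 2) ^ 2) ^ 2 * ∑ m, a m ^ 2 := h1
    _ ≤ 4 * ((L : ℝ) ^ 2 - 1) / 3 * ((∑ l, p l ^ 2) / 4) ^ 2 * ∑ m, a m ^ 2 := by gcongr
    _ = ((L : ℝ) ^ 2 - 1) / 12 * (∑ l, p l ^ 2) ^ 2 * ∑ m, a m ^ 2 := by ring

/-- The same closed form on a COMPLEX polarisation `ε` (the note's `ε†d(p)ε`, phases absorbed):
`Σ_mΣ_n h_mn ‖sin(p_n∕2)ε_m − sin(p_m∕2)ε_n‖²`. -/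
def defectFormC (L : ℕ) (p : ι → ℝ) (ε : ι → ℂ) : ℝ :=
  ∑ m, ∑ n, hW L p m n * ‖(sin (p n / 2) : ℂ) * ε m - (sin (p m / 2) : ℂ) * ε n‖ ^ 2

omit [DecidableEq ι] in
/-- Real∕imaginary splitting: `ε†d(p)ε = D_L(p)[Re ε] + D_L(p)[Im ε]`. [folklore] -/
theorem defectFormC_eq (L : ℕ) (p : ι → ℝ) (ε : ι → ℂ) :
    defectFormC L p ε = defectForm L p (fun m => (ε m).re) + defectForm L p (fun m => (ε m).im) := by
  unfold defectFormC defectForm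
  rw [← Finset.sum_add_distrib]
  refine Finset.sum_congr rfl fun m _ => ?_
  rw [← Finset.sum_add_distrib]
  refine Finset.sum_congr rfl fun n _ => ?_
  rw [Complex.sq_norm, Complex.normSq_apply]
  simp only [Complex.sub_re, Complex.sub_im, Complex.mul_re, Complex.mul_im, Complex.ofReal_re,
    Complex.ofReal_im, zero_mul, sub_zero, add_zero]
  ring

omit [DecidableEq ι] in
/-- `0 ≤ ε†d(p)ε` on complex polarisations. [folklore] -/
theorem defectFormC_nonneg (L : ℕ) (p : ι → ℝ) (ε : ι → ℂ) : 0 ≤ defectFormC L p ε := by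
  rw [defectFormC_eq]
  exact add_nonneg (defectForm_nonneg L p _) (defectForm_nonneg L p _)

/-- **K2a on complex polarisations:** `ε†d(p)ε ≤ ((L²−1)∕12)·|p|⁴·Σ_m‖ε_m‖²` for all `p`, `L ≥ 1`. [folklore] -/
theorem defectFormC_le {L : ℕ} (hL : 1 ≤ L) (p : ι → ℝ) (ε : ι → ℂ) :
    defectFormC L p ε ≤ ((L : ℝ) ^ 2 - 1) / 12 * (∑ l, p l ^ 2) ^ 2 * ∑ m, ‖ε m‖ ^ 2 := by
  rw [defectFormC_eq]
  have h1 := defectForm_le hL p (fun m => (ε m).re)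
  have h2 := defectForm_le hL p (fun m => (ε m).im)
  have hsplit : ∑ m, ‖ε m‖ ^ 2 = ∑ m, (ε m).re ^ 2 + ∑ m, (ε m).im ^ 2 := by
    rw [← Finset.sum_add_distrib]
    refine Finset.sum_congr rfl fun m _ => ?_
    rw [Complex.sq_norm, Complex.normSq_apply]; ring
  rw [hsplit, mul_add]
  exact add_le_add h1 h2

/-! ## §5 The scalar block-mean defect and the `d = 1` Laplacian defect -/

/-- The scalar (0-form) block-mean defect symbol `D0_L(p) = Σ_μ 4 sin²(p_μ∕2)·(1 − g(p_μ)·Π_λ g(p_λ))`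
(fine Laplacian symbol minus `|S(p)|²×` the coarse Laplacian symbol, `S(p) = Π_λ s(p_λ)`). -/
def scalarDefect (L : ℕ) (p : ι → ℝ) : ℝ :=
  ∑ m, 4 * sin (p m / 2) ^ 2 * (1 - gSym L (p m) * ∏ l, gSym L (p l))

omit [DecidableEq ι] in
/-- `0 ≤ D0_L(p)` (the scalar Jensen sign, mode by mode). [folklore] -/
theorem scalarDefect_nonneg (L : ℕ) (p : ι → ℝ) : 0 ≤ scalarDefect L p := by
  refine Finset.sum_nonneg fun m _ => mul_nonneg (by positivity) ?_
  have a0 := gSym_nonneg L (p m); have a1 := gSym_le_one L (p m)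
  have c0 := prod_gSym_nonneg L p; have c1 := prod_gSym_le_one L p
  nlinarith

/-- **SCALAR K2a (the planner's `D0`, promoted from leading form to GLOBAL bound).**  For `L ≥ 1`:
`D0_L(p) ≤ ((L²−1)∕12)·((Σ_μ p_μ²)² + Σ_μ p_μ⁴)`. [folklore] -/
theorem scalarDefect_le {L : ℕ} (hL : 1 ≤ L) (p : ι → ℝ) :
    scalarDefect L p ≤ ((L : ℝ) ^ 2 - 1) / 12 * ((∑ l, p l ^ 2) ^ 2 + ∑ l, p l ^ 4) := by
  set S : ℝ := ∑ l, sin (p l / 2) ^ 2 with hS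
  set c : ℝ := ((L : ℝ) ^ 2 - 1) / 3 with hc
  have hc0 : 0 ≤ c := by
    have : (1 : ℝ) ≤ L := by exact_mod_cast hL
    have : (1 : ℝ) ≤ (L : ℝ) ^ 2 := by nlinarith
    rw [hc]; linarith
  have hS0 : 0 ≤ S := Finset.sum_nonneg fun l _ => sq_nonneg _
  have hprod : 1 - ∏ l, gSym L (p l) ≤ c * S := by
    calc 1 - ∏ l, gSym L (p l) ≤ ∑ l, (1 - gSym L (p l)) :=
          one_sub_prod_le_sum _ _ (fun l _ => gSym_nonneg L (p l)) fun l _ => gSym_le_one L (p l)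
      _ ≤ ∑ l, c * sin (p l / 2) ^ 2 := Finset.sum_le_sum fun l _ => one_sub_gSym_le hL (p l)
      _ = c * S := by rw [Finset.mul_sum]
  -- termwise bound
  have term : ∀ m, 4 * sin (p m / 2) ^ 2 * (1 - gSym L (p m) * ∏ l, gSym L (p l))
      ≤ 4 * c * (sin (p m / 2) ^ 2 * sin (p m / 2) ^ 2) + 4 * c * S * sin (p m / 2) ^ 2 := by
    intro m
    have a0 := gSym_nonneg L (p m); have a1 := gSym_le_one L (p m)
    have c0 := prod_gSym_nonneg L p; have c1 := prod_gSym_le_one L p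
    have split : 1 - gSym L (p m) * ∏ l, gSym L (p l) ≤ (1 - gSym L (p m)) + (1 - ∏ l, gSym L (p l)) := by
      nlinarith [mul_nonneg (sub_nonneg.2 a1) (sub_nonneg.2 c1)]
    have hm : 1 - gSym L (p m) ≤ c * sin (p m / 2) ^ 2 := by rw [hc]; exact one_sub_gSym_le hL (p m)
    have hx0 : 0 ≤ 4 * sin (p m / 2) ^ 2 := by positivity
    calc 4 * sin (p m / 2) ^ 2 * (1 - gSym L (p m) * ∏ l, gSym L (p l))
        ≤ 4 * sin (p m / 2) ^ 2 * (c * sin (p m / 2) ^ 2 + c * S) := by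
          apply mul_le_mul_of_nonneg_left _ hx0
          linarith
      _ = _ := by ring
  have hsin4 : ∀ m, sin (p m / 2) ^ 2 * sin (p m / 2) ^ 2 ≤ p m ^ 4 / 16 := by
    intro m
    have h := sin_sq_half_le (p m)
    have h0 : 0 ≤ sin (p m / 2) ^ 2 := sq_nonneg _
    calc sin (p m / 2) ^ 2 * sin (p m / 2) ^ 2 ≤ (p m ^ 2 / 4) * (p m ^ 2 / 4) :=
          mul_le_mul h h h0 (by positivity)
      _ = p m ^ 4 / 16 := by ring
  have hSle : S ≤ (∑ l, p l ^ 2) / 4 := sum_sin_sq_half_le p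
  calc scalarDefect L p
      ≤ ∑ m, (4 * c * (sin (p m / 2) ^ 2 * sin (p m / 2) ^ 2) + 4 * c * S * sin (p m / 2) ^ 2) :=
        Finset.sum_le_sum fun m _ => term m
    _ = 4 * c * ∑ m, sin (p m / 2) ^ 2 * sin (p m / 2) ^ 2 + 4 * c * S * S := by
        rw [Finset.sum_add_distrib, ← Finset.mul_sum, ← Finset.mul_sum]
    _ ≤ 4 * c * ∑ m, p m ^ 4 / 16 + 4 * c * ((∑ l, p l ^ 2) / 4) * ((∑ l, p l ^ 2) / 4) := by
        have h4 : ∑ m, sin (p m / 2) ^ 2 * sin (p m / 2) ^ 2 ≤ ∑ m, p m ^ 4 / 16 :=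
          Finset.sum_le_sum fun m _ => hsin4 m
        have h5 : 4 * c * S * S ≤ 4 * c * ((∑ l, p l ^ 2) / 4) * ((∑ l, p l ^ 2) / 4) := by
          have := mul_le_mul hSle hSle hS0 (by positivity)
          nlinarith
        nlinarith [mul_le_mul_of_nonneg_left h4 (by positivity : (0:ℝ) ≤ 4 * c)]
    _ = ((L : ℝ) ^ 2 - 1) / 12 * ((∑ l, p l ^ 2) ^ 2 + ∑ l, p l ^ 4) := by
        rw [hc, ← Finset.sum_div]; ring

/-- The `d = 1` Laplacian defect symbol of `g49/HOM-JUNCTION` §2 ∕ P-HOM-1 (scalar chain, block length `L`, coarse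
spacing `L`): `D1_L(θ) = Δ̂_f(θ) − g(θ)·Δ̂_c(θ) = 4 sin²(θ∕2)·(1 − g(θ)²)` (using `g·L² sin²(θ∕2) = sin²(Lθ∕2)`). -/
def laplaceDefect (L : ℕ) (θ : ℝ) : ℝ := 4 * sin (θ / 2) ^ 2 * (1 - gSym L θ ^ 2)

/-- `0 ≤ D1_L(θ)`. [folklore] -/
theorem laplaceDefect_nonneg (L : ℕ) (θ : ℝ) : 0 ≤ laplaceDefect L θ := by
  unfold laplaceDefect
  have a0 := gSym_nonneg L θ; have a1 := gSym_le_one L θ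
  have : gSym L θ ^ 2 ≤ 1 := by nlinarith
  have : 0 ≤ 1 - gSym L θ ^ 2 := by linarith
  positivity

/-- **`d = 1` K2a: `D1_L(θ) ≤ ((L²−1)∕6)·θ⁴` globally** (the closed form's leading coefficient `(L²−1)x⁴∕6`). [folklore] -/
theorem laplaceDefect_le {L : ℕ} (hL : 1 ≤ L) (θ : ℝ) :
    laplaceDefect L θ ≤ ((L : ℝ) ^ 2 - 1) / 6 * θ ^ 4 := by
  unfold laplaceDefect
  have a0 := gSym_nonneg L θ; have a1 := gSym_le_one L θ
  have hg := one_sub_gSym_le hL θ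
  have hs := sin_sq_half_le θ
  have hs0 : 0 ≤ sin (θ / 2) ^ 2 := sq_nonneg _
  have hL' : (0 : ℝ) ≤ ((L : ℝ) ^ 2 - 1) := by
    have : (1 : ℝ) ≤ L := by exact_mod_cast hL
    nlinarith
  -- 1 − g² = (1 − g)(1 + g) ≤ 2(1 − g)
  have h1 : 1 - gSym L θ ^ 2 ≤ 2 * (((L : ℝ) ^ 2 - 1) / 3 * sin (θ / 2) ^ 2) := by nlinarith
  calc 4 * sin (θ / 2) ^ 2 * (1 - gSym L θ ^ 2)
      ≤ 4 * sin (θ / 2) ^ 2 * (2 * (((L : ℝ) ^ 2 - 1) / 3 * sin (θ / 2) ^ 2)) :=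
        mul_le_mul_of_nonneg_left h1 (by positivity)
    _ = 8 * ((L : ℝ) ^ 2 - 1) / 3 * (sin (θ / 2) ^ 2 * sin (θ / 2) ^ 2) := by ring
    _ ≤ 8 * ((L : ℝ) ^ 2 - 1) / 3 * ((θ ^ 2 / 4) * (θ ^ 2 / 4)) := by
        apply mul_le_mul_of_nonneg_left _ (by positivity)
        exact mul_le_mul hs hs hs0 (by positivity)
    _ = ((L : ℝ) ^ 2 - 1) / 6 * θ ^ 4 := by ring

end Summit.QuantumFields.BalabanUV.T4Continuum.NE7BlockDefectSymbolBound

end
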